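import Summits.QuantumFields.YangMills.Theorems.LocalInsertionBoxAxialLipschitz
import Summits.QuantumFields.YangMills.Theorems.LocalInsertionLevelZeroUniformSU2T3
import Literature.MathematicalPhysics.QuantumFieldTheory.Balaban1983to89.T4PairDerivBridge
import HarnessLib

/-!
# Crux `HistoryTailL` (stmt-QuantumFields-19936), line #12 organ K1 — THE CRUDE ROAD'S EXACT REACH AT EVERY BOX SIDE:
# Gaussian concentration of local gauge-invariant Lipschitz observables with the explicit polynomial loss `(Cc·n³, n⁵)`

Cell `ym3-torus` (YM ladder rung R3 = continuum SU(2) Yang–Mills on the 3-torus — NOT d = 4, NOT infinite volume, NOT a mass gap, NOT the Clay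
problem), width seat `ym-ust-19936-w4` gen 12; LEAD ★w1-19936 g8 DISPATCH 04:55:44Z (3) «a kernel certificate of the `n⁻³` reach in the stub's letters»;
`--supports stmt-QuantumFields-19936 --as helper`.  Companion of the located memo `K1-MESOSCOPIC-LOCATE-w4g12.md` (19936 evidence #46).

WHAT THIS FILE CERTIFIES.  The deciding crux `PoincareLipschitz.MesoscopicConcentrationL` (stmt-QuantumFields-23532; NOT claimed, NOT restated, NOT
proved) asks `gibbsK{r ≤ f − ∫f} ≤ Cc·exp(−cc·β_K·r²∕(n²Λ²))` with `Cc, cc` INDEPENDENT of the box side `n ≤ β_K`, for every box-local, gauge-invariant,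
`Λ`-Lipschitz (in the `ℓ²` link metric) observable `f` — Gaussian concentration at the massless (Hodge–Poincaré) scale `n²∕β_K`; its mesoscopic half
`17L³ < n` is line #12's organ stub `stub_mesoscopicBoxConcentration`.  ★★`boxConcentration_crude` below is THAT TEXT WITH EXACTLY TWO TOKEN CHANGES —
`Cc ↦ Cc·n³` and `n² ↦ n⁵` — for EVERY side `n ≥ 1` (no `n ≤ N₀`), with `Cc, cc, γ₁` ABSOLUTE given the level-0 constant `A`: the honest reach of the
elementary road «prefactor-free level-0 plaquette tail (✓`LevelZeroUniformSU2T3.exists_gibbsK_real_dist1_ge_le`, `e^{A}e^{−β_Kθ²∕8}`) + axial gauge on the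
box (✓`BoxAxialLipschitz.abs_sub_apply_one_le_of_box_plaqSmall`, `|f U − f 1| ≤ Λ·√(3n³)·2(n−1)·max_q dist1 U(∂q)`) + union bound over the `≤ 9n³` box
plaquettes + layer cake».  Read against the crux: `cc_crude(n) = cc∕n³` — the located content of K1 is precisely the removal of this VOLUME factor
`3n³ = #links` (the Cauchy–Schwarz step `ℓ∞ → ℓ²`); the entropy `9n³` only enters the prefactor, and the axial length `(2(n−1))²` is the crux's own `n²`.
✓`BoxConcentrationBounded.boxConcentration_bounded` (the same text with the guard `n ≤ N₀` and `N₀`-dependent constants) is the bounded-side corollary.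

* §1 `integral_le_sqrt_log_add_of_gaussian_tail` — the TRUNCATED layer cake: on a probability space, `g ≥ 0` integrable with
  `μ{θ < g} ≤ M·e^{−cθ²}` (`M ≥ 1`, `c > 0`) has `∫g ≤ √(log M ∕ c) + √(π∕c)∕2` (the count `M` enters through `√log M`, not linearly — this is what keeps
  the centring `|∫f − f 1|` at the tail's own scale).
* §2 `factorSq_le`, `plaqCount_le`, `centring_sq_le`, `smallCase_exponent_le`, `largeCase_exponent_le`, `count_le_prefactor`,
  `one_le_prefactor_mul_exp` (the real arithmetic of the constants, isolated so that the assembly elaborates at default heartbeats), ★★`boxConcentration_crude`.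

HONEST: a CERTIFICATE OF THE ELEMENTARY ROAD'S REACH (polynomial loss displayed), not progress on the organ: at the consumer's parameters
(`n = 17L^j`, `Λ = CL·L^{−j∕2}`, `r = θ∕4`) the loss `n³` is the `L^{3j}` «averaging is smoothing» gap, reach `j = O(log K)`; K1 (n-uniform `cc`) is a
local log-Sobolev ∕ spectral-gap statement at weak coupling and is NOT touched.  THEOREMS ONLY, definition-free.
[cite: Balaban1985UV3, (3) p.256 and (39)-(40) p.266]
-/

set_option autoImplicit false

noncomputable section

open scoped BigOperators
open MeasureTheory
open Literature.MathematicalPhysics.QuantumFieldTheory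
open Literature.MathematicalPhysics.QuantumFieldTheory.Balaban1983to89
open Literature.MathematicalPhysics.QuantumFieldTheory.Balaban1983to89.T3ContinuumYM3Torus
open Literature.MathematicalPhysics.QuantumFieldTheory.Balaban1983to89.T3UnitScaleTilt
open Literature.MathematicalPhysics.QuantumFieldTheory.Balaban1983to89.T3UnitLawDensityEML
open Literature.MathematicalPhysics.QuantumFieldTheory.Balaban1983to89.T4PairDerivBridge (dist1_le_two_specialUnitaryGroup)
open Summit.QuantumFields.YangMills.Theorems.LocalInsertion.BoxAxialLipschitz (abs_sub_apply_one_le_of_box_plaqSmall card_filter_plaq_box_le)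
open Summit.QuantumFields.YangMills.Theorems.LocalInsertion.ExpMomentSU2UniformT3 (integral_le_of_gaussian_tail)
open Summit.QuantumFields.YangMills.Theorems.LocalInsertion.LevelZeroUniformSU2T3 (exists_gibbsK_real_dist1_ge_le)

namespace Summit.QuantumFields.YangMills.Theorems.LocalInsertion.BoxConcentrationCrude

/-! ## §1 The truncated layer cake -/

/-- **Truncated layer cake against a Gaussian tail with a count.**  On a probability space, if `g ≥ 0` is integrable and
`μ{θ < g} ≤ M·e^{−cθ²}` for all `θ > 0` with `M ≥ 1`, `c > 0`, then `∫ g dμ ≤ √(log M ∕ c) + √(π∕c)∕2`: below `θ₀ := √(log M∕c)` use `μ ≤ 1`, above it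
`M·e^{−c(θ₀+θ)²} ≤ e^{−cθ²}` and the plain layer cake ✓`integral_le_of_gaussian_tail` for the excess `(g − θ₀)₊`. [folklore] -/
theorem integral_le_sqrt_log_add_of_gaussian_tail {Ω : Type*} [MeasurableSpace Ω] {μ : Measure Ω} [IsProbabilityMeasure μ]
    {g : Ω → ℝ} (hgi : Integrable g μ) {M c : ℝ} (hM : 1 ≤ M) (hc : 0 < c)
    (htail : ∀ θ : ℝ, 0 < θ → μ.real {ω | θ < g ω} ≤ M * Real.exp (-c * θ ^ 2)) :
    ∫ ω, g ω ∂μ ≤ Real.sqrt (Real.log M / c) + Real.sqrt (Real.pi / c) / 2 := by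
  have hMpos : 0 < M := by linarith
  have hlogM : 0 ≤ Real.log M := Real.log_nonneg hM
  set θ₀ : ℝ := Real.sqrt (Real.log M / c) with hθ₀
  have hθ₀0 : 0 ≤ θ₀ := Real.sqrt_nonneg _
  have hθ₀sq : c * θ₀ ^ 2 = Real.log M := by
    rw [hθ₀, Real.sq_sqrt (div_nonneg hlogM hc.le)]; field_simp
  -- the excess above `θ₀`
  set h : Ω → ℝ := fun ω => max (g ω - θ₀) 0 with hh
  have hh0 : ∀ ω, 0 ≤ h ω := fun ω => le_max_right _ _
  have hgh : ∀ ω, g ω ≤ θ₀ + h ω := fun ω => by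
    have : g ω - θ₀ ≤ h ω := le_max_left _ _
    linarith
  have hhi : Integrable h μ := (hgi.sub (integrable_const θ₀)).pos_part
  have htail' : ∀ θ : ℝ, 0 < θ → μ.real {ω | θ < h ω} ≤ 1 * Real.exp (-c * θ ^ 2) := by
    intro θ hθ
    have hset : {ω | θ < h ω} = {ω | θ + θ₀ < g ω} := by
      ext ω
      simp only [Set.mem_setOf_eq, hh, lt_max_iff]
      constructor
      · rintro (h1 | h1)
        · linarith
        · exact absurd h1 (not_lt.2 hθ.le)
      · intro h1; left; linarith
    rw [hset, one_mul]
    refine (htail (θ + θ₀) (by linarith)).trans ?_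
    have h2 : Real.exp (-c * (θ + θ₀) ^ 2) ≤ Real.exp (-c * θ ^ 2 - Real.log M) := by
      apply Real.exp_le_exp.2
      have : 0 ≤ c * (θ * θ₀) := mul_nonneg hc.le (mul_nonneg hθ.le hθ₀0)
      nlinarith [hθ₀sq]
    calc M * Real.exp (-c * (θ + θ₀) ^ 2) ≤ M * Real.exp (-c * θ ^ 2 - Real.log M) :=
          mul_le_mul_of_nonneg_left h2 hMpos.le
      _ = Real.exp (-c * θ ^ 2) := by rw [Real.exp_sub, Real.exp_log hMpos]; field_simp
  have hinth : ∫ ω, h ω ∂μ ≤ 1 * (Real.sqrt (Real.pi / c) / 2) :=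
    integral_le_of_gaussian_tail hh0 zero_le_one hc htail'
  calc ∫ ω, g ω ∂μ ≤ ∫ ω, (θ₀ + h ω) ∂μ := integral_mono hgi ((integrable_const θ₀).add hhi) hgh
    _ = θ₀ + ∫ ω, h ω ∂μ := by
        rw [integral_add (integrable_const θ₀) hhi, integral_const, smul_eq_mul, probReal_univ, one_mul]
    _ ≤ Real.sqrt (Real.log M / c) + Real.sqrt (Real.pi / c) / 2 := by rw [hθ₀] at *; linarith

/-! ## §2 The crude road at every box side -/

/-- Arithmetic: the squared deterministic factor of the box of side `n ≥ 1` (d = 3), `(√(3n³)·(2(n−1)) + 1)² ≤ 12·n⁵`. [folklore] -/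
theorem factorSq_le {n : ℕ} (hn : 1 ≤ n) :
    (Real.sqrt ((3 : ℝ) * (n : ℝ) ^ 3) * ((((3 - 1 : ℕ) : ℝ)) * (((n - 1 : ℕ) : ℝ))) + 1) ^ 2 ≤ 12 * (n : ℝ) ^ 5 := by
  have hn1 : (1 : ℝ) ≤ (n : ℝ) := by exact_mod_cast hn
  have hnm : (((n - 1 : ℕ) : ℝ)) = (n : ℝ) - 1 := by
    rw [Nat.cast_sub hn, Nat.cast_one]
  have h31 : (((3 - 1 : ℕ) : ℝ)) = 2 := by norm_num
  rw [hnm, h31]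
  set s : ℝ := Real.sqrt ((3 : ℝ) * (n : ℝ) ^ 3) with hs
  have hs0 : 0 ≤ s := Real.sqrt_nonneg _
  have h3n : (0 : ℝ) ≤ 3 * (n : ℝ) ^ 3 := by positivity
  have hssq : s ^ 2 = 3 * (n : ℝ) ^ 3 := by rw [hs, Real.sq_sqrt h3n]
  -- `s ≤ 3n³` since `3n³ ≥ 1`
  have hs_le : s ≤ 3 * (n : ℝ) ^ 3 := by
    have h1 : (1 : ℝ) ≤ 3 * (n : ℝ) ^ 3 := by nlinarith [one_le_pow₀ (M₀ := ℝ) hn1 (n := 3)]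
    have : 3 * (n : ℝ) ^ 3 ≤ (3 * (n : ℝ) ^ 3) ^ 2 := by nlinarith
    calc s ≤ Real.sqrt ((3 * (n : ℝ) ^ 3) ^ 2) := Real.sqrt_le_sqrt this
      _ = 3 * (n : ℝ) ^ 3 := Real.sqrt_sq (by positivity)
  have hn0 : (0 : ℝ) ≤ (n : ℝ) - 1 := by linarith
  have hn4 : (1 : ℝ) ≤ (n : ℝ) ^ 4 := one_le_pow₀ hn1
  -- `(s·2(n−1) + 1)² = 4s²(n−1)² + 4s(n−1) + 1 = 12n⁵ − 24n⁴ + 12n³ + 4(sn − s) + 1 ≤ 12n⁵`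
  have hst : s * (n : ℝ) - s ≤ 3 * (n : ℝ) ^ 4 - 3 * (n : ℝ) ^ 3 := by
    have := mul_le_mul_of_nonneg_right hs_le hn0
    nlinarith [this]
  have expand : (s * (2 * ((n : ℝ) - 1)) + 1) ^ 2 =
      4 * s ^ 2 * (n : ℝ) ^ 2 - 8 * s ^ 2 * (n : ℝ) + 4 * s ^ 2 + 4 * (s * (n : ℝ)) - 4 * s + 1 := by ring
  rw [expand, hssq]
  nlinarith [hst, hn4]

/-- Arithmetic: `9n³ + 1 ≤ 10n³` for `n ≥ 1`. [folklore] -/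
theorem plaqCount_le {n : ℕ} (hn : 1 ≤ n) : (9 : ℝ) * (n : ℝ) ^ 3 + 1 ≤ 10 * (n : ℝ) ^ 3 := by
  have hn1 : (1 : ℝ) ≤ (n : ℝ) := by exact_mod_cast hn
  nlinarith [one_le_pow₀ (M₀ := ℝ) hn1 (n := 3)]

/-- Arithmetic of the centring: `(2·(√(ℓ∕c) + √(π∕c)∕2))² ≤ (8ℓ + 2π)∕c` for `ℓ ≥ 0`, `c > 0` (`(a + b∕2)² ≤ 2a² + b²∕2`). [folklore] -/
theorem centring_sq_le {ℓ c : ℝ} (hℓ : 0 ≤ ℓ) (hc : 0 < c) :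
    (2 * (Real.sqrt (ℓ / c) + Real.sqrt (Real.pi / c) / 2)) ^ 2 ≤ (8 * ℓ + 2 * Real.pi) / c := by
  set a : ℝ := Real.sqrt (ℓ / c) with ha'
  set b : ℝ := Real.sqrt (Real.pi / c) with hb'
  have ha : a ^ 2 = ℓ / c := Real.sq_sqrt (div_nonneg hℓ hc.le)
  have hb : b ^ 2 = Real.pi / c := Real.sq_sqrt (div_nonneg Real.pi_pos.le hc.le)
  have h2 : (a + b / 2) ^ 2 ≤ 2 * a ^ 2 + b ^ 2 / 2 := by nlinarith [sq_nonneg (a - b / 2)]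
  have h5 : (8 * ℓ + 2 * Real.pi) / c = 8 * (ℓ / c) + 2 * (Real.pi / c) := by ring
  rw [h5, ← ha, ← hb]
  nlinarith [h2]

/-- Arithmetic of the small-`r` case: with `M² ≤ 12Λ²N` (`N = n⁵`), `c₀ = β∕(8M²)`, `cc = 1∕768`, the centring in the exponent's currency is
`cc·β·((8ℓ + 2π)∕c₀)∕(NΛ²) ≤ ℓ + 1`. [folklore] -/
theorem smallCase_exponent_le {β Λ N M ℓ : ℝ} (hβ : 0 < β) (hΛ : 0 < Λ) (hN : 0 < N)
    (hM : M ^ 2 ≤ 12 * Λ ^ 2 * N) (hℓ : 0 ≤ ℓ) :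
    1 / 768 * β * ((8 * ℓ + 2 * Real.pi) / (β / (8 * M ^ 2))) / (N * Λ ^ 2) ≤ ℓ + 1 := by
  have hden : 0 < N * Λ ^ 2 := by positivity
  have hX : 0 ≤ 8 * ℓ + 2 * Real.pi := by linarith [Real.pi_pos]
  have h2 : 1 / 768 * β * ((8 * ℓ + 2 * Real.pi) / (β / (8 * M ^ 2))) = 1 / 768 * (8 * ℓ + 2 * Real.pi) * (8 * M ^ 2) := by
    rw [div_div_eq_mul_div, mul_div_assoc', div_eq_iff hβ.ne']
    ring
  have h3 : 1 / 768 * (8 * ℓ + 2 * Real.pi) * (8 * M ^ 2) ≤ 1 / 768 * (8 * ℓ + 2 * Real.pi) * (8 * (12 * Λ ^ 2 * N)) :=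
    mul_le_mul_of_nonneg_left (by linarith [hM]) (mul_nonneg (by norm_num) hX)
  rw [div_le_iff₀ hden, h2]
  have hπ : Real.pi ≤ 4 := Real.pi_le_four
  calc 1 / 768 * (8 * ℓ + 2 * Real.pi) * (8 * M ^ 2) ≤ 1 / 768 * (8 * ℓ + 2 * Real.pi) * (8 * (12 * Λ ^ 2 * N)) := h3
    _ = ((8 * ℓ + 2 * Real.pi) / 8) * (N * Λ ^ 2) := by ring
    _ ≤ (ℓ + 1) * (N * Λ ^ 2) := by
        refine mul_le_mul_of_nonneg_right ?_ hden.le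
        linarith

/-- Arithmetic of the large-`r` case: with `M² ≤ 12Λ²N`, `cc·β·r²∕(NΛ²) ≤ (β∕(8M²))·(r∕2)²` (`cc = 1∕768 ≤ 1∕384`). [folklore] -/
theorem largeCase_exponent_le {β Λ N M : ℝ} (r : ℝ) (hβ : 0 < β) (hΛ : 0 < Λ) (hN : 0 < N) (hM0 : 0 < M)
    (hM : M ^ 2 ≤ 12 * Λ ^ 2 * N) :
    1 / 768 * β * r ^ 2 / (N * Λ ^ 2) ≤ β / (8 * M ^ 2) * (r / 2) ^ 2 := by
  have hβr : 0 ≤ β * r ^ 2 := by positivity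
  have hMpos : 0 < 32 * M ^ 2 := by positivity
  have e1 : β / (8 * M ^ 2) * (r / 2) ^ 2 = β * r ^ 2 / (32 * M ^ 2) := by ring
  have e2 : 1 / 768 * β * r ^ 2 / (N * Λ ^ 2) = β * r ^ 2 / (768 * (N * Λ ^ 2)) := by ring
  rw [e1, e2, div_le_div_iff₀ (by positivity) hMpos]
  have h32 : 32 * M ^ 2 ≤ 768 * (N * Λ ^ 2) := by nlinarith [hM]
  exact mul_le_mul_of_nonneg_left h32 hβr

/-- Arithmetic of the prefactor: `Np·E ≤ 10·e·E·n³` for `Np ≤ 10n³`, `E > 0`. [folklore] -/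
theorem count_le_prefactor {E Np n3 : ℝ} (hE : 0 < E) (hn3 : 0 ≤ n3) (hNp : Np ≤ 10 * n3) :
    Np * E ≤ 10 * Real.exp 1 * E * n3 := by
  have h1e : (1 : ℝ) ≤ Real.exp 1 := Real.one_le_exp zero_le_one
  have h1 : Np * E ≤ 10 * n3 * E := mul_le_mul_of_nonneg_right hNp hE.le
  have h0 : 0 ≤ 10 * n3 * E := by positivity
  calc Np * E ≤ 10 * n3 * E := h1
    _ ≤ 10 * n3 * E * Real.exp 1 := le_mul_of_one_le_right h0 h1e
    _ = 10 * Real.exp 1 * E * n3 := by ring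

/-- Arithmetic of the small-`r` case, prefactor side: `1 ≤ 10·e·E·n³·exp(−(log(Np·E) + 1))` for `0 < Np ≤ 10n³`, `E > 0`. [folklore] -/
theorem one_le_prefactor_mul_exp {E Np n3 : ℝ} (hE : 0 < E) (hNp0 : 0 < Np) (hNp : Np ≤ 10 * n3) :
    1 ≤ 10 * Real.exp 1 * E * n3 * Real.exp (-(Real.log (Np * E) + 1)) := by
  have hNpE0 : 0 < Np * E := mul_pos hNp0 hE
  have he : Real.exp (-(Real.log (Np * E) + 1)) = (Np * E * Real.exp 1)⁻¹ := by
    rw [Real.exp_neg, Real.exp_add, Real.exp_log hNpE0]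
  have hpos : 0 < Np * E * Real.exp 1 := by positivity
  rw [he, ← div_eq_mul_inv, le_div_iff₀ hpos, one_mul]
  calc Np * E * Real.exp 1 ≤ 10 * n3 * E * Real.exp 1 :=
        mul_le_mul_of_nonneg_right (mul_le_mul_of_nonneg_right hNp hE.le) (Real.exp_pos 1).le
    _ = 10 * Real.exp 1 * E * n3 := by ring

/-- ★★ **THE CRUDE ROAD AT EVERY BOX SIDE — GAUSSIAN CONCENTRATION WITH THE EXPLICIT POLYNOMIAL LOSS `(Cc·n³, n⁵)`.**  For every `L` there are
ABSOLUTE `Cc ≥ 0`, `cc > 0` (`cc = 1∕768`), `γ₁ = 1∕8` such that for every `T3Family F` with `F.L = L`, every `γ ∈ (0, γ₁]`, every cut-off `K`, EVERY box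
side `n ≥ 1` with the crux's guards `n ≤ β_K`, `2n ≤ sitesPerDir` (the first is not even used), every corner `x₀`, and every measurable, gauge-invariant
`f` of the level-0 field that depends only on the bonds with both ends in the box `x₀ + [0,n)³` and is `Λ`-Lipschitz (`Λ > 0`) in the `ℓ²` link metric:
`gibbsK{r ≤ f − ∫f} ≤ Cc·n³·exp(−cc·β_K·r²∕(n⁵Λ²))` for all `r ≥ 0` — the text of `PoincareLipschitz.MesoscopicConcentrationL` with EXACTLY the two token
changes `Cc ↦ Cc·n³`, `n² ↦ n⁵`.  Proof: prefactor-free level-0 plaquette tail + axial gauge on the box + union bound + TRUNCATED layer cake (§1) + two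
cases at `r = 2·(centring)`.  Read against the crux: the elementary road's `cc` decays like `n⁻³` (the Cauchy–Schwarz volume `#links = 3n³`); K1 = its
removal = NOT this file. [cite: Balaban1985UV3, (3) p.256 and (39)-(40) p.266] -/
theorem boxConcentration_crude : ∀ (L : ℕ), ∃ (Cc cc : ℝ), 0 ≤ Cc ∧ 0 < cc ∧ ∃ γ₁ : ℝ, 0 < γ₁ ∧ γ₁ ≤ 1 ∧
    ∀ (F : T3Family) (γ : ℝ), F.L = L → 0 < γ → γ ≤ γ₁ → ∀ (K n : ℕ), 1 ≤ n →
      (n : ℝ) ≤ (F.scheme ℰp γ).β K → 2 * n ≤ (F.P K).sitesPerDir 0 →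
      ∀ (x₀ : Site (F.P K) 0) (f : GaugeField (F.P K) 0 (Matrix.specialUnitaryGroup (Fin 2) ℂ) → ℝ) (Λ : ℝ), 0 < Λ →
        Measurable f → GaugeField.GaugeInvariant f →
        (∀ U U' : GaugeField (F.P K) 0 (Matrix.specialUnitaryGroup (Fin 2) ℂ),
          (∀ b : PBond (F.P K) 0, (∀ k, (b.src k - x₀ k).val < n) → (∀ k, (b.tgt k - x₀ k).val < n) → U b = U' b) → f U = f U') →
        (∀ U U' : GaugeField (F.P K) 0 (Matrix.specialUnitaryGroup (Fin 2) ℂ),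
          |f U - f U'| ≤ Λ * Real.sqrt (∑ b : PBond (F.P K) 0, GaugeGroup.dist1 (U b * (U' b)⁻¹) ^ 2)) →
        ∀ r : ℝ, 0 ≤ r →
          (gibbsK F ℰp γ K).real {U | r ≤ f U - ∫ V, f V ∂(gibbsK F ℰp γ K)} ≤
            Cc * (n : ℝ) ^ 3 * Real.exp (-(cc * (F.scheme ℰp γ).β K * r ^ 2 / ((n : ℝ) ^ 5 * Λ ^ 2))) := by
  intro L
  obtain ⟨A, hA⟩ := exists_gibbsK_real_dist1_ge_le
  -- the constants (absolute given `A`): `E := e^{max A 0}`, `Cc := 10·e·E`, `cc := 1∕768`, `γ₁ := 1∕8`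
  set E : ℝ := Real.exp (max A 0) with hE
  have hE1 : 1 ≤ E := by rw [hE]; exact Real.one_le_exp (le_max_right _ _)
  have hE0 : 0 < E := by linarith
  have hEA : Real.exp A ≤ E := by rw [hE]; exact Real.exp_le_exp.2 (le_max_left _ _)
  refine ⟨10 * Real.exp 1 * E, 1 / 768, by positivity, by norm_num, 1 / 8, by norm_num, by norm_num, ?_⟩
  intro F γ _hFL hγ hγ8 K n hn _hnβ h2n x₀ f Λ hΛ hfm hinv hloc hLip r hr
  -- the measure and the coupling
  haveI := isProbabilityMeasure_gibbsK F ℰp hγ.le K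
  set μ := gibbsK F ℰp γ K with hμ
  set β : ℝ := (F.scheme ℰp γ).β K with hβ
  have hβ8 : 8 ≤ β := by
    -- `β_K = (γ ε_K)⁻¹ ≥ 8` for `γ ≤ 1∕8`, `ε_K ≤ 1` (as in ✓`BoxConcentrationBounded.boxConcentration_bounded`)
    have hβe : β = (γ * (F.P K).eps)⁻¹ := rfl
    have hε0 : 0 < (F.P K).eps := (F.P K).eps_pos
    have hε1 : (F.P K).eps ≤ 1 := by
      have hL : (1 : ℝ) ≤ ((F.P K).L : ℝ) := by exact_mod_cast (F.P K).hL.2.le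
      unfold Params.eps
      exact pow_le_one₀ (inv_nonneg.2 (by positivity)) (inv_le_one_of_one_le₀ hL)
    rw [hβe, le_inv_comm₀ (by norm_num) (mul_pos hγ hε0)]
    calc γ * (F.P K).eps ≤ 1 / 8 * 1 := mul_le_mul hγ8 hε1 hε0.le (by norm_num)
      _ = 8⁻¹ := by norm_num
  have hβ0 : 0 < β := by linarith
  have hd : (F.P K).d = 3 := T3Family.P_d F K
  have hn1 : (1 : ℝ) ≤ (n : ℝ) := by exact_mod_cast hn
  have hn0 : (0 : ℝ) < (n : ℝ) := by linarith
  have hn5 : (0 : ℝ) < (n : ℝ) ^ 5 := by positivity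
  -- §a the deterministic input: all box plaquettes within `δ` ⇒ `|f U − f 1| ≤ M₁ δ`, `M₁ := Λ·Mf`, `Mf² ≤ 12 n⁵`
  set Mf : ℝ := Real.sqrt ((3 : ℝ) * (n : ℝ) ^ 3) * ((((3 - 1 : ℕ) : ℝ)) * (((n - 1 : ℕ) : ℝ))) + 1 with hMf
  have hMf0 : 0 < Mf := by positivity
  have hMfsq : Mf ^ 2 ≤ 12 * (n : ℝ) ^ 5 := factorSq_le hn
  set M₁ : ℝ := Λ * Mf with hM₁
  have hM₁0 : 0 < M₁ := mul_pos hΛ hMf0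
  have hM₁sq : M₁ ^ 2 ≤ 12 * Λ ^ 2 * (n : ℝ) ^ 5 :=
    calc M₁ ^ 2 = Λ ^ 2 * Mf ^ 2 := by rw [hM₁, mul_pow]
      _ ≤ Λ ^ 2 * (12 * (n : ℝ) ^ 5) := mul_le_mul_of_nonneg_left hMfsq (sq_nonneg Λ)
      _ = 12 * Λ ^ 2 * (n : ℝ) ^ 5 := by ring
  have hdet : ∀ (δ : ℝ), 0 ≤ δ → ∀ U : GaugeField (F.P K) 0 (Matrix.specialUnitaryGroup (Fin 2) ℂ),
      (∀ q : Plaq (F.P K) 0, (∀ k, (q.src k - x₀ k).val < n) → dist1 (GaugeField.plaqHol U q) < δ) → |f U - f 1| ≤ M₁ * δ := by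
    intro δ hδ U hU
    have h := abs_sub_apply_one_le_of_box_plaqSmall x₀ hn h2n f hΛ.le hinv hloc hLip hδ U hU
    rw [hd] at h
    have hfac : Real.sqrt ((3 : ℝ) * (n : ℝ) ^ 3) * ((((3 - 1 : ℕ) : ℝ)) * (((n - 1 : ℕ) : ℝ))) ≤ Mf :=
      le_add_of_nonneg_right zero_le_one
    calc |f U - f 1| ≤ Λ * (Real.sqrt ((3 : ℝ) * (n : ℝ) ^ 3) * ((((3 - 1 : ℕ) : ℝ)) * (((n - 1 : ℕ) : ℝ)))) * δ := by
          simpa using h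
      _ ≤ Λ * Mf * δ := by
          refine mul_le_mul_of_nonneg_right (mul_le_mul_of_nonneg_left hfac hΛ.le) hδ
      _ = M₁ * δ := by rw [hM₁]
  -- §b the tail of `g := |f − f 1|`: union bound over the ≤ `9n³` box plaquettes × the prefactor-free plaquette tail
  classical
  set Q : Finset (Plaq (F.P K) 0) := Finset.univ.filter fun q => ∀ k, (q.src k - x₀ k).val < n with hQ
  set Np : ℝ := 9 * (n : ℝ) ^ 3 + 1 with hNp
  have hNp1 : 1 ≤ Np := by have := pow_nonneg hn0.le 3; rw [hNp]; linarith
  have hNp0 : 0 < Np := by linarith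
  have hNp10 : Np ≤ 10 * (n : ℝ) ^ 3 := plaqCount_le hn
  have hQcard : (Q.card : ℝ) ≤ Np := by
    have h1 : Q.card ≤ (F.P K).d ^ 2 * n ^ (F.P K).d := card_filter_plaq_box_le x₀ n
    rw [hd] at h1
    have h2 : ((Q.card : ℕ) : ℝ) ≤ ((3 ^ 2 * n ^ 3 : ℕ) : ℝ) := by exact_mod_cast h1
    push_cast at h2
    rw [hNp]; linarith
  set g : GaugeField (F.P K) 0 (Matrix.specialUnitaryGroup (Fin 2) ℂ) → ℝ := fun U => |f U - f 1| with hg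
  set c₀ : ℝ := β / (8 * M₁ ^ 2) with hc₀
  have hc₀pos : 0 < c₀ := by positivity
  have htail : ∀ θ : ℝ, 0 < θ → μ.real {U | θ < g U} ≤ (Np * E) * Real.exp (-c₀ * θ ^ 2) := by
    intro θ hθ
    set δ : ℝ := θ / M₁ with hδ
    have hδ0 : 0 < δ := div_pos hθ hM₁0
    -- `{θ < g} ⊆ ⋃_{q ∈ Q} {δ ≤ dist1 U(∂q)}`
    have hsub : {U | θ < g U} ⊆ ⋃ q ∈ Q, {U | δ ≤ dist1 (GaugeField.plaqHol U q)} := by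
      intro U hU
      simp only [Set.mem_setOf_eq] at hU
      by_contra hnot
      simp only [Set.mem_iUnion, Set.mem_setOf_eq, not_exists, not_le] at hnot
      have hall : ∀ q : Plaq (F.P K) 0, (∀ k, (q.src k - x₀ k).val < n) → dist1 (GaugeField.plaqHol U q) < δ :=
        fun q hq => hnot q (by rw [hQ]; simpa using hq)
      have h := hdet δ hδ0.le U hall
      have : M₁ * δ = θ := by rw [hδ]; field_simp
      rw [this] at h
      exact absurd hU (not_lt.2 h)
    calc μ.real {U | θ < g U} ≤ μ.real (⋃ q ∈ Q, {U | δ ≤ dist1 (GaugeField.plaqHol U q)}) :=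
          measureReal_mono hsub (measure_ne_top _ _)
      _ ≤ ∑ q ∈ Q, μ.real {U | δ ≤ dist1 (GaugeField.plaqHol U q)} := measureReal_biUnion_finset_le Q _
      _ ≤ ∑ _q ∈ Q, E * Real.exp (-(1 / 2 * (β / 2) * δ ^ 2 / 2)) :=
          Finset.sum_le_sum fun q _ => by
            rw [hμ, hβ]
            exact (hA F ℰp γ K hβ8 δ hδ0.le q).trans (mul_le_mul_of_nonneg_right hEA (Real.exp_pos _).le)
      _ = (Q.card : ℝ) * (E * Real.exp (-(1 / 2 * (β / 2) * δ ^ 2 / 2))) := by rw [Finset.sum_const, nsmul_eq_mul]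
      _ ≤ Np * (E * Real.exp (-(1 / 2 * (β / 2) * δ ^ 2 / 2))) := mul_le_mul_of_nonneg_right hQcard (by positivity)
      _ = (Np * E) * Real.exp (-c₀ * θ ^ 2) := by
          have hexp : -(1 / 2 * (β / 2) * δ ^ 2 / 2) = -c₀ * θ ^ 2 := by
            rw [hδ, hc₀]; field_simp; ring
          rw [hexp, mul_assoc]
  -- §c the centring by the TRUNCATED layer cake: `|∫f − f 1| ≤ m := √(log(Np·E)∕c₀) + √(π∕c₀)∕2`
  have hNpE1 : 1 ≤ Np * E := one_le_mul_of_one_le_of_one_le hNp1 hE1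
  have hlog0 : 0 ≤ Real.log (Np * E) := Real.log_nonneg hNpE1
  set m : ℝ := Real.sqrt (Real.log (Np * E) / c₀) + Real.sqrt (Real.pi / c₀) / 2 with hm
  have hm0 : 0 ≤ m := by positivity
  have hbound : ∀ U, |f U| ≤ |f 1| + Λ * Real.sqrt (∑ _b : PBond (F.P K) 0, (2 : ℝ) ^ 2) := by
    intro U
    have h1 := hLip U 1
    have h2 : Real.sqrt (∑ b : PBond (F.P K) 0, GaugeGroup.dist1 (U b * ((1 : GaugeField (F.P K) 0 _) b)⁻¹) ^ 2) ≤
        Real.sqrt (∑ _b : PBond (F.P K) 0, (2 : ℝ) ^ 2) := by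
      refine Real.sqrt_le_sqrt (Finset.sum_le_sum fun b _ => ?_)
      exact pow_le_pow_left₀ (GaugeGroup.dist1_nonneg _) (dist1_le_two_specialUnitaryGroup _) 2
    have h3 : |f U - f 1| ≤ Λ * Real.sqrt (∑ _b : PBond (F.P K) 0, (2 : ℝ) ^ 2) := h1.trans (mul_le_mul_of_nonneg_left h2 hΛ.le)
    have := abs_sub_abs_le_abs_sub (f U) (f 1)
    linarith
  have hfint : Integrable f μ :=
    Integrable.mono' (integrable_const (|f 1| + Λ * Real.sqrt (∑ _b : PBond (F.P K) 0, (2 : ℝ) ^ 2))) hfm.aestronglyMeasurable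
      (ae_of_all _ fun U => by rw [Real.norm_eq_abs]; exact hbound U)
  have hgint : Integrable g μ := (hfint.sub (integrable_const (f 1))).abs
  have hgle : ∫ U, g U ∂μ ≤ m := integral_le_sqrt_log_add_of_gaussian_tail hgint hNpE1 hc₀pos htail
  have hcentre : |∫ V, f V ∂μ - f 1| ≤ m := by
    have h1 : ∫ V, f V ∂μ - f 1 = ∫ V, (f V - f 1) ∂μ := by
      rw [integral_sub hfint (integrable_const _), integral_const, smul_eq_mul, probReal_univ, one_mul]
    rw [h1]
    calc |∫ V, (f V - f 1) ∂μ| ≤ ∫ V, |f V - f 1| ∂μ := abs_integral_le_integral_abs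
      _ ≤ m := hgle
  -- the size of the centring in the exponent's currency: `cc·β·(2m)²∕(n⁵Λ²) ≤ log(Np·E) + 1`
  have hmsq : (2 * m) ^ 2 ≤ (8 * Real.log (Np * E) + 2 * Real.pi) / c₀ := centring_sq_le hlog0 hc₀pos
  have hden : 0 < (n : ℝ) ^ 5 * Λ ^ 2 := by positivity
  have hsmall : 1 / 768 * β * (2 * m) ^ 2 / ((n : ℝ) ^ 5 * Λ ^ 2) ≤ Real.log (Np * E) + 1 := by
    have h1 : 1 / 768 * β * (2 * m) ^ 2 / ((n : ℝ) ^ 5 * Λ ^ 2) ≤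
        1 / 768 * β * ((8 * Real.log (Np * E) + 2 * Real.pi) / c₀) / ((n : ℝ) ^ 5 * Λ ^ 2) :=
      div_le_div_of_nonneg_right (mul_le_mul_of_nonneg_left hmsq (by positivity)) hden.le
    exact h1.trans (smallCase_exponent_le hβ0 hΛ hn5 hM₁sq hlog0)
  -- §d the two cases
  have hLHS1 : μ.real {U | r ≤ f U - ∫ V, f V ∂μ} ≤ 1 := measureReal_le_one
  by_cases hr2 : r ≤ 2 * m
  · -- small `r`: the claimed bound is `≥ 1`
    have hx : 1 / 768 * β * r ^ 2 / ((n : ℝ) ^ 5 * Λ ^ 2) ≤ Real.log (Np * E) + 1 := by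
      have hr2' : r ^ 2 ≤ (2 * m) ^ 2 := pow_le_pow_left₀ hr hr2 2
      have : 1 / 768 * β * r ^ 2 / ((n : ℝ) ^ 5 * Λ ^ 2) ≤ 1 / 768 * β * (2 * m) ^ 2 / ((n : ℝ) ^ 5 * Λ ^ 2) :=
        div_le_div_of_nonneg_right (mul_le_mul_of_nonneg_left hr2' (by positivity)) hden.le
      exact this.trans hsmall
    have hkey : 1 ≤ 10 * Real.exp 1 * E * (n : ℝ) ^ 3 * Real.exp (-(Real.log (Np * E) + 1)) :=
      one_le_prefactor_mul_exp hE0 hNp0 hNp10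
    calc μ.real {U | r ≤ f U - ∫ V, f V ∂μ} ≤ 1 := hLHS1
      _ ≤ 10 * Real.exp 1 * E * (n : ℝ) ^ 3 * Real.exp (-(Real.log (Np * E) + 1)) := hkey
      _ ≤ 10 * Real.exp 1 * E * (n : ℝ) ^ 3 * Real.exp (-(1 / 768 * β * r ^ 2 / ((n : ℝ) ^ 5 * Λ ^ 2))) := by
          refine mul_le_mul_of_nonneg_left (Real.exp_le_exp.2 (neg_le_neg hx)) (by positivity)
  · -- large `r`: `{r ≤ f − ∫f} ⊆ {r∕2 < g}`
    replace hr2 : 2 * m < r := not_le.1 hr2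
    have hsub : {U | r ≤ f U - ∫ V, f V ∂μ} ⊆ {U | r / 2 < g U} := by
      intro U hU
      simp only [Set.mem_setOf_eq] at hU ⊢
      have h1 : f U - f 1 = (f U - ∫ V, f V ∂μ) + (∫ V, f V ∂μ - f 1) := by ring
      have h2 : -m ≤ ∫ V, f V ∂μ - f 1 := (abs_le.1 hcentre).1
      calc r / 2 < r - m := by linarith
        _ ≤ f U - f 1 := by rw [h1]; linarith
        _ ≤ g U := le_abs_self _
    have hθ : 0 < r / 2 := by linarith
    have hstep1 : μ.real {U | r ≤ f U - ∫ V, f V ∂μ} ≤ μ.real {U | r / 2 < g U} :=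
      measureReal_mono hsub (measure_ne_top _ _)
    have hstep2 : μ.real {U | r / 2 < g U} ≤ (Np * E) * Real.exp (-c₀ * (r / 2) ^ 2) := htail (r / 2) hθ
    -- exponents: `cc·β·r²∕(n⁵Λ²) ≤ c₀·(r∕2)² = β r²∕(32 M₁²)` since `M₁² ≤ 12Λ²n⁵` and `cc = 1∕768 ≤ 1∕384`
    have hexp : 1 / 768 * β * r ^ 2 / ((n : ℝ) ^ 5 * Λ ^ 2) ≤ c₀ * (r / 2) ^ 2 :=
      largeCase_exponent_le r hβ0 hΛ hn5 hM₁0 hM₁sq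
    have hpref : Np * E ≤ 10 * Real.exp 1 * E * (n : ℝ) ^ 3 := count_le_prefactor hE0 (pow_nonneg hn0.le 3) hNp10
    have hstep3 : (Np * E) * Real.exp (-c₀ * (r / 2) ^ 2) ≤
        10 * Real.exp 1 * E * (n : ℝ) ^ 3 * Real.exp (-(1 / 768 * β * r ^ 2 / ((n : ℝ) ^ 5 * Λ ^ 2))) := by
      refine mul_le_mul hpref (Real.exp_le_exp.2 ?_) (Real.exp_pos _).le (by positivity)
      rw [neg_mul]
      exact neg_le_neg hexp
    exact hstep1.trans (hstep2.trans hstep3)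

end Summit.QuantumFields.YangMills.Theorems.LocalInsertion.BoxConcentrationCrude

end
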